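import Mathlib
import Summits.Ventures.PercRepro.TriangleCapSparseTwo

/-!
# PercRepro — the one-triangle case of the dense-corner stability at `k = 7`, `m ≥ 11` (p3, gen 35; part 35f)

`one_triangle_stability_seven`: a `K₄⁻`-free graph on `7` vertices with `m ≥ 11` edges whose triangles all lie
on `{u, v, w}` has `Σ_v d(v)² + 5 ≤ 7m`.  The gen-34 proof (`2q + ab + bc + ca ≥ 4` on the partition
`a + b + c + q = 4`) fails exactly on the partitions `(0, 1, 3, 0)`, `(0, 3, 1, 0)` and their permutations,
where the second sparse exception (TriangleCapSparseTwo) gives `2m ≤ 6 + 2 + 6 + 6 = 20`, and on the partitions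
with two empty private neighbourhoods, where the first one gives `2m + 10 ≤ 28` — both below `m = 11`.
Axioms: standard.
-/

namespace PercRepro

namespace TriangleCap

namespace C047

open Finset

variable {V : Type*} [Fintype V] [DecidableEq V]

/-- **THE ONE-TRIANGLE CASE AT `k = 7` IN THE DENSE CORNER (`m ≥ 11`)** — the gen-34 proof with the second
sparse exception on the partitions `(0, 1, 3, 0)` and their permutations. -/
theorem one_triangle_stability_seven (D : SimpleGraph V) [DecidableRel D.Adj] (hK : K4mFree D)
    (hk : Fintype.card V = 7) {u v w : V} (huv : D.Adj u v) (huw : D.Adj u w) (hvw : D.Adj v w)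
    (hT : ∀ a b c, D.Adj a b → D.Adj a c → D.Adj b c → a = u ∨ a = v ∨ a = w)
    (hm : 2 * Fintype.card V ≤ D.edgeFinset.card + 3) :
    ∑ v, deg D v * deg D v + (Fintype.card V - 2) ≤ D.edgeFinset.card * Fintype.card V := by
  have hpart := card_partition_triangle D hK huv huw hvw
  have hvu : D.Adj v u := huv.symm
  have hwu : D.Adj w u := huw.symm
  have hwv : D.Adj w v := hvw.symm
  -- the pointwise far-pair bound
  have hL : ∀ z, (if z = u then cross D (priv D v u w) (priv D w u v) else 0) +
      (if z = v then cross D (priv D u v w) (priv D w u v) else 0) +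
      (if z = w then cross D (priv D u v w) (priv D v u w) else 0) +
      (if z ∈ priv D u v w then 2 + 2 * ((priv D v u w).filter (fun y => ¬ D.Adj z y)).card +
        2 * ((priv D w u v).filter (fun y => ¬ D.Adj z y)).card else 0) +
      (if z ∈ priv D v u w then 2 + 2 * ((priv D u v w).filter (fun y => ¬ D.Adj z y)).card +
        2 * ((priv D w u v).filter (fun y => ¬ D.Adj z y)).card else 0) +
      (if z ∈ priv D w u v then 2 + 2 * ((priv D u v w).filter (fun y => ¬ D.Adj z y)).card +
        2 * ((priv D v u w).filter (fun y => ¬ D.Adj z y)).card else 0) +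
      (if z ∈ outer D u v w then 6 else 0) ≤ far D z := by
    intro z
    rcases classify_triangle D hK huv huw hvw z with rfl | rfl | rfl | hz | hz | hz | hz
    · have h1 : z ∉ priv D z v w := by rw [mem_priv]; exact fun h => h.1.ne rfl
      have h2 : z ∉ priv D v z w := by rw [mem_priv]; exact fun h => h.2.2 hwu
      have h3 : z ∉ priv D w z v := by rw [mem_priv]; exact fun h => h.2.2 hvu
      have h4 : z ∉ outer D z v w := by rw [mem_outer]; exact fun h => h.2.1 hvu
      simp only [if_true, if_neg huv.ne, if_neg huw.ne, if_neg h1, if_neg h2, if_neg h3, if_neg h4,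
        add_zero]
      exact far_ge_cross D z v w
    · have h1 : z ∉ priv D u z w := by rw [mem_priv]; exact fun h => h.2.2 hwv
      have h2 : z ∉ priv D z u w := by rw [mem_priv]; exact fun h => h.1.ne rfl
      have h3 : z ∉ priv D w u z := by rw [mem_priv]; exact fun h => h.2.1 huv
      have h4 : z ∉ outer D u z w := by rw [mem_outer]; exact fun h => h.1 huv
      simp only [if_true, if_neg huv.ne.symm, if_neg hvw.ne, if_neg h1, if_neg h2, if_neg h3, if_neg h4,
        add_zero, zero_add]
      have := far_ge_cross D z u w
      rw [priv_comm D w z u] at this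
      exact this
    · have h1 : z ∉ priv D u v z := by rw [mem_priv]; exact fun h => h.2.1 hvw
      have h2 : z ∉ priv D v u z := by rw [mem_priv]; exact fun h => h.2.1 huw
      have h3 : z ∉ priv D z u v := by rw [mem_priv]; exact fun h => h.1.ne rfl
      have h4 : z ∉ outer D u v z := by rw [mem_outer]; exact fun h => h.1 huw
      simp only [if_true, if_neg huw.ne.symm, if_neg hvw.ne.symm, if_neg h1, if_neg h2, if_neg h3,
        if_neg h4, add_zero, zero_add]
      have := far_ge_cross D z u v
      rw [priv_comm D u z v, priv_comm D v z u] at this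
      exact this
    · have hz' := (mem_priv D u v w z).mp hz
      have hzu : z ≠ u := fun h => hz'.1.ne h.symm
      have hzv : z ≠ v := fun h => hz'.2.2 (h ▸ hwv)
      have hzw : z ≠ w := fun h => hz'.2.1 (h ▸ hvw)
      have h2 : z ∉ priv D v u w := by rw [mem_priv]; exact fun h => hz'.2.1 h.1
      have h3 : z ∉ priv D w u v := by rw [mem_priv]; exact fun h => hz'.2.2 h.1
      have h4 : z ∉ outer D u v w := by rw [mem_outer]; exact fun h => h.1 hz'.1
      simp only [if_neg hzu, if_neg hzv, if_neg hzw, if_pos hz, if_neg h2, if_neg h3, if_neg h4,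
        add_zero, zero_add]
      exact far_ge_of_mem_priv D huv huw hvw hz
    · have hz' := (mem_priv D v u w z).mp hz
      have hzu : z ≠ u := fun h => hz'.2.2 (h ▸ hwu)
      have hzv : z ≠ v := fun h => hz'.1.ne h.symm
      have hzw : z ≠ w := fun h => hz'.2.1 (h ▸ huw)
      have h1 : z ∉ priv D u v w := by rw [mem_priv]; exact fun h => hz'.2.1 h.1
      have h3 : z ∉ priv D w u v := by rw [mem_priv]; exact fun h => hz'.2.2 h.1
      have h4 : z ∉ outer D u v w := by rw [mem_outer]; exact fun h => h.2.1 hz'.1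
      simp only [if_neg hzu, if_neg hzv, if_neg hzw, if_neg h1, if_pos hz, if_neg h3, if_neg h4,
        add_zero, zero_add]
      have := far_ge_of_mem_priv D hvu hvw huw hz
      rw [priv_comm D w v u] at this
      exact this
    · have hz' := (mem_priv D w u v z).mp hz
      have hzu : z ≠ u := fun h => hz'.2.2 (h ▸ hvu)
      have hzv : z ≠ v := fun h => hz'.2.1 (h ▸ huv)
      have hzw : z ≠ w := fun h => hz'.1.ne h.symm
      have h1 : z ∉ priv D u v w := by rw [mem_priv]; exact fun h => hz'.2.1 h.1
      have h2 : z ∉ priv D v u w := by rw [mem_priv]; exact fun h => hz'.2.2 h.1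
      have h4 : z ∉ outer D u v w := by rw [mem_outer]; exact fun h => h.2.2 hz'.1
      simp only [if_neg hzu, if_neg hzv, if_neg hzw, if_neg h1, if_neg h2, if_pos hz, if_neg h4,
        add_zero, zero_add]
      have := far_ge_of_mem_priv D hwu hwv huv hz
      rw [priv_comm D u w v, priv_comm D v w u] at this
      exact this
    · have hz' := (mem_outer D u v w z).mp hz
      have hzu : z ≠ u := fun h => hz'.2.1 (h ▸ hvu)
      have hzv : z ≠ v := fun h => hz'.1 (h ▸ huv)
      have hzw : z ≠ w := fun h => hz'.1 (h ▸ huw)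
      have h1 : z ∉ priv D u v w := by rw [mem_priv]; exact fun h => hz'.1 h.1
      have h2 : z ∉ priv D v u w := by rw [mem_priv]; exact fun h => hz'.2.1 h.1
      have h3 : z ∉ priv D w u v := by rw [mem_priv]; exact fun h => hz'.2.2 h.1
      simp only [if_neg hzu, if_neg hzv, if_neg hzw, if_neg h1, if_neg h2, if_neg h3, if_pos hz,
        zero_add]
      exact far_ge_six_of_mem_outer D huv huw hvw hz
  have hsum := sum_le_sum (fun z (_ : z ∈ univ) => hL z)
  rw [← sum_deficit_eq_sum_far] at hsum
  simp only [sum_add_distrib, sum_ite_eq', mem_univ, if_true, sum_ite_mem, univ_inter, sum_const,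
    smul_eq_mul, ← mul_sum] at hsum
  -- the cross-pair counts
  have d1 : Disjoint (priv D v u w) (priv D w u v) := by
    rw [disjoint_left]; intro y h1 h2; rw [mem_priv] at h1 h2; exact h2.2.2 h1.1
  have d2 : Disjoint (priv D u v w) (priv D w u v) := by
    rw [disjoint_left]; intro y h1 h2; rw [mem_priv] at h1 h2; exact h2.2.1 h1.1
  have d3 : Disjoint (priv D u v w) (priv D v u w) := by
    rw [disjoint_left]; intro y h1 h2; rw [mem_priv] at h1 h2; exact h2.2.1 h1.1
  have c1 := cross_add_sum_ge D _ _ d1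
  have c2 := cross_add_sum_ge D _ _ d2
  have c3 := cross_add_sum_ge D _ _ d3
  have hid := two_mul_sum_deg_sq_add_sum_deficit D
  have hT6 := card_triangles3_le_six D hT
  -- names
  set a := (priv D u v w).card with ha
  set b := (priv D v u w).card with hb
  set c := (priv D w u v).card with hc
  set q := (outer D u v w).card with hq
  have hF : 2 * a + 2 * b + 2 * c + 6 * q + 2 * (b * c) + 2 * (a * c) + 2 * (a * b) ≤
      ∑ p ∈ adjPairsAll D, deficit D p := by omega
  obtain ⟨t, ht⟩ : ∃ t, Fintype.card V = t + 2 := ⟨Fintype.card V - 2, by omega⟩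
  have e : Fintype.card V - 2 = t := by omega
  rw [e]
  have hmk : 2 * (D.edgeFinset.card * Fintype.card V) = 2 * D.edgeFinset.card * Fintype.card V := by ring
  -- the main case: `2q + ab + bc + ca ≥ 4`
  have main : 4 ≤ 2 * q + (b * c + a * c + a * b) →
      ∑ v, deg D v * deg D v + t ≤ D.edgeFinset.card * Fintype.card V := by
    intro h4
    omega
  by_cases hq2 : 2 ≤ q
  · exact main (by omega)
  have hq1 : q ≤ 1 := by omega
  have hpart4 : a + b + c + q = 4 := by omega
  have hvu : D.Adj v u := huv.symm
  have hwu : D.Adj w u := huw.symm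
  have hwv : D.Adj w v := hvw.symm
  have hT' : ∀ x y z, D.Adj x y → D.Adj x z → D.Adj y z → x = v ∨ x = w ∨ x = u := by
    intro x y z h1 h2 h3
    rcases hT x y z h1 h2 h3 with h | h | h
    · exact Or.inr (Or.inr h)
    · exact Or.inl h
    · exact Or.inr (Or.inl h)
  have hT'' : ∀ x y z, D.Adj x y → D.Adj x z → D.Adj y z → x = u ∨ x = w ∨ x = v := by
    intro x y z h1 h2 h3
    rcases hT x y z h1 h2 h3 with h | h | h
    · exact Or.inl h
    · exact Or.inr (Or.inr h)
    · exact Or.inr (Or.inl h)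
  by_cases hbc : 1 ≤ b ∧ 1 ≤ c
  · by_cases ha1 : 1 ≤ a
    · apply main
      have h1 : b ≤ a * b := Nat.le_mul_of_pos_left b ha1
      have h2 : c ≤ a * c := Nat.le_mul_of_pos_left c ha1
      have h1' : a ≤ a * b := Nat.le_mul_of_pos_right a hbc.1
      have h2' : a ≤ a * c := Nat.le_mul_of_pos_right a hbc.2
      have h3 : b + c ≤ b * c + 1 := mul_ge_add_sub_one b c hbc.1 hbc.2
      omega
    · have ha0 : a = 0 := by omega
      have hab0 : a * b = 0 := by rw [ha0, zero_mul]
      have hac0 : a * c = 0 := by rw [ha0, zero_mul]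
      by_cases hbad : (b = 1 ∧ c = 3) ∨ (b = 3 ∧ c = 1)
      · exfalso
        have hq0 : q = 0 := by omega
        have hu : priv D u v w = ∅ := card_eq_zero.mp ha0
        have hQ : outer D v w u = ∅ := by rw [outer_comm₂]; exact card_eq_zero.mp hq0
        have h := sparse_of_priv_one D hK hvw hvu hwu hT' hu hQ
        rw [priv_comm D v w u, priv_comm D w v u] at h
        rw [← hb, ← hc] at h
        rcases hbad with ⟨hb1, hc3⟩ | ⟨hb3, hc1⟩
        · rw [hb1, hc3] at h; omega
        · rw [hb3, hc1] at h; omega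
      · apply main
        have hb3 : b ≤ 3 := by omega
        have hc3 : c ≤ 3 := by omega
        have key : 4 ≤ 2 * q + b * c := by
          obtain ⟨hb, hc⟩ := hbc
          interval_cases b <;> interval_cases c <;> omega
        omega
  by_cases hac : 1 ≤ a ∧ 1 ≤ c
  · have hb0 : b = 0 := by omega
    have hab0 : a * b = 0 := by rw [hb0, mul_zero]
    have hbc0 : b * c = 0 := by rw [hb0, zero_mul]
    by_cases hbad : (a = 1 ∧ c = 3) ∨ (a = 3 ∧ c = 1)
    · exfalso
      have hq0 : q = 0 := by omega
      have hv : priv D v u w = ∅ := card_eq_zero.mp hb0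
      have hQ : outer D u w v = ∅ := by rw [outer_comm₂, outer_comm₁]; exact card_eq_zero.mp hq0
      have h := sparse_of_priv_one D hK huw huv hwv hT'' hv hQ
      rw [priv_comm D u w v] at h
      rw [← ha, ← hc] at h
      rcases hbad with ⟨ha1, hc3⟩ | ⟨ha3, hc1⟩
      · rw [ha1, hc3] at h; omega
      · rw [ha3, hc1] at h; omega
    · apply main
      have ha3 : a ≤ 3 := by omega
      have hc3 : c ≤ 3 := by omega
      have key : 4 ≤ 2 * q + a * c := by
        obtain ⟨ha, hc⟩ := hac
        interval_cases a <;> interval_cases c <;> omega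
      omega
  by_cases hab : 1 ≤ a ∧ 1 ≤ b
  · have hc0 : c = 0 := by omega
    have hac0 : a * c = 0 := by rw [hc0, mul_zero]
    have hbc0 : b * c = 0 := by rw [hc0, mul_zero]
    by_cases hbad : (a = 1 ∧ b = 3) ∨ (a = 3 ∧ b = 1)
    · exfalso
      have hq0 : q = 0 := by omega
      have hw : priv D w u v = ∅ := card_eq_zero.mp hc0
      have hQ : outer D u v w = ∅ := card_eq_zero.mp hq0
      have h := sparse_of_priv_one D hK huv huw hvw hT hw hQ
      rw [← ha, ← hb] at h
      rcases hbad with ⟨ha1, hb3⟩ | ⟨ha3, hb1⟩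
      · rw [ha1, hb3] at h; omega
      · rw [ha3, hb1] at h; omega
    · apply main
      have ha3 : a ≤ 3 := by omega
      have hb3 : b ≤ 3 := by omega
      have key : 4 ≤ 2 * q + a * b := by
        obtain ⟨ha, hb⟩ := hab
        interval_cases a <;> interval_cases b <;> omega
      omega
  -- the sparse exception: two private neighbourhoods are empty
  exfalso
  have hk5 : 5 ≤ Fintype.card V := by omega
  have hcases : (b = 0 ∧ c = 0) ∨ (a = 0 ∧ c = 0) ∨ (a = 0 ∧ b = 0) := by omega
  rcases hcases with ⟨hb0, hc0⟩ | ⟨ha0, hc0⟩ | ⟨ha0, hb0⟩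
  · have hv : priv D v u w = ∅ := card_eq_zero.mp hb0
    have hw : priv D w u v = ∅ := card_eq_zero.mp hc0
    have := sparse_of_priv_empty D hK huv huw hvw hT hv hw hq1 hk5
    omega
  · have hv' : priv D u v w = ∅ := card_eq_zero.mp ha0
    have hw' : priv D w v u = ∅ := by rw [priv_comm]; exact card_eq_zero.mp hc0
    have hq' : (outer D v u w).card ≤ 1 := by rw [← outer_comm₁]; exact hq1
    have hT3 : ∀ x y z, D.Adj x y → D.Adj x z → D.Adj y z → x = v ∨ x = u ∨ x = w := by
      intro x y z h1 h2 h3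
      rcases hT x y z h1 h2 h3 with h | h | h
      · exact Or.inr (Or.inl h)
      · exact Or.inl h
      · exact Or.inr (Or.inr h)
    have := sparse_of_priv_empty D hK hvu hvw huw hT3 hv' hw' hq' hk5
    omega
  · have hv' : priv D u w v = ∅ := by rw [priv_comm]; exact card_eq_zero.mp ha0
    have hw' : priv D v w u = ∅ := by rw [priv_comm]; exact card_eq_zero.mp hb0
    have hq' : (outer D w u v).card ≤ 1 := by rw [← outer_comm₂]; exact hq1
    have hT4 : ∀ x y z, D.Adj x y → D.Adj x z → D.Adj y z → x = w ∨ x = u ∨ x = v := by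
      intro x y z h1 h2 h3
      rcases hT x y z h1 h2 h3 with h | h | h
      · exact Or.inr (Or.inl h)
      · exact Or.inr (Or.inr h)
      · exact Or.inl h
    have := sparse_of_priv_empty D hK hwu hwv huv hT4 hv' hw' hq' hk5
    omega

end C047

end TriangleCap

end PercRepro
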